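import Summits.BirchSwinnertonDyer.BirchSwinnertonDyer.Theorems.ErratumRoadFiveKernelUpper
import Summits.BirchSwinnertonDyer.BirchSwinnertonDyer.Theorems.ErratumRoadFiveShimuraUpperHalf
import Summits.BirchSwinnertonDyer.BirchSwinnertonDyer.Theses.ErratumRoadFive
import Literature.NumberTheory.Automorphic.ShimuraCurveRibetTakahashiComponentPackage
import Literature.NumberTheory.EllipticCurves.ShimuraCurveHeegnerPointKolyvagin
import HarnessLib

/-!
# Route `ErratumRoadFive` (rung K2a): the `closes` term with crux `ShimuraDisplays` (item 19063) CASHED IN for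
# three published named facts (cell `bsd-stepL`, seat `bsd-stepL-shim-p1` g2; planner's SHIM cash-in package)

`--supports stmt-BirchSwinnertonDyer-19063`, HELPER (no route decl is closed: the conclusion is the rung leaf
`X11b.MultiplicativeRankOne`, the hypotheses are the route's OTHER items plus named facts).

`Theses.ErratumRoadFive.closes` consumes crux 3 `ShimuraDisplays` only through the kernel binder `hSh` of
`X11b.multiplicativeRankOne_of_endState`, i.e. only for the Euler-system half on (ram) ∧ ¬(T2α), which is the
THEOREM `missingUpperBoundAt_of_classX11b_of_ram_of_not_alpha_pub` (`Theorems/ErratumRoadFiveShimuraUpperHalf.lean`,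
p420149) from Jacquet–Langlands (`nonempty_shimuraParametrizationData`), Pasten 2024 §6
(`PastenShimura2024_ribetTakahashiPackage`, p419786) and Cai–Shu–Tian 2014 Thm. 1.5 + JSW 2017 Thm. 4.4.1
(`shimuraCurve_heegnerPoint_grossZagier_kolyvagin`, p419798) together with six conjuncts of `PublishedInputsFive`.
With the kernel re-keyed on that consumed bound (`Theorems/ErratumRoadFiveKernelUpper.lean`,
`multiplicativeRankOne_of_endState_upper`, route-importable), the `closes` term re-glues with the crux replaced by
the conjunction of the three facts (the planner's by-name support item `ShimuraCurveInputs`, shared with the K2@3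
routes): `erratumRoadFive_multiplicativeRankOne_of_shimuraCurveInputs`. The planner's `--closes-file` is its body
with `h₃ : ShimuraCurveInputs`. (PART 3, `ErratumRoadFiveShimuraPublished.lean` p421825, states the same
implication through PART 2, whose module imports the route file and so cannot serve `closes`.)

HONEST FRAMING: THEOREMS ONLY; no new mathematics; CONDITIONAL on the items and the named facts (at `p ∥ N⁺`
the Kolyvagin conjunct is JSW Thm. 4.4.1 AS PRINTED — reading flag `JSW17-Thm441-Nekovar-primary`); nothing
booked; X11b stays CONSTRUCTION-SHAPED; BSD is not proved by any of this.
-/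

noncomputable section

open scoped Classical

open WeierstrassCurve NumberField IsDedekindDomain Literature.NumberTheory.EllipticCurves
  Rat.HeightOneSpectrum
  Literature.NumberTheory.EllipticCurves.ModularForms
  Literature.NumberTheory.EllipticCurves.Rank1Residual
  Literature.NumberTheory.EllipticCurves.Rank1Residual.Typed
  Literature.NumberTheory.EllipticCurves.Wuthrich2014
  Literature.NumberTheory.EllipticCurves.BalakrishnanEtAl2019
  Literature.NumberTheory.GaloisRepresentations Literature.NumberTheory.GaloisCohomology
  Literature.NumberTheory.Automorphic
  Summit.BirchSwinnertonDyer.Rank1Residual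
  Summit.BirchSwinnertonDyer.Rank1Residual.X11b
  Summit.BirchSwinnertonDyer.BirchSwinnertonDyer.Theses.ErratumRoadFive

-- the cell's Theorems namespace repeats the summit name (Summit.<Summit>.<Problem>), as in every sibling file
set_option linter.dupNamespace false

namespace Summit.BirchSwinnertonDyer.BirchSwinnertonDyer.Theorems

/-- **Route `ErratumRoadFive`: the re-glued `closes` with crux `ShimuraDisplays` (item 19063) CASHED IN.** The
rung-K2a leaf `X11b.MultiplicativeRankOne` from the route's items `OpenInputIMC`, `EulerHalfOffLocus`,
`X11aLowerHalf`, `NonSurjCorner`, `PublishedInputsFive` and — in place of the crux `ShimuraDisplays` — the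
conjunction of three PUBLISHED named facts of the tree (the planner's by-name support item `ShimuraCurveInputs`):
Jacquet–Langlands `nonempty_shimuraParametrizationData`, Pasten 2024 §6 `PastenShimura2024_ribetTakahashiPackage`,
Cai–Shu–Tian 2014 Thm. 1.5 + JSW 2017 Thm. 4.4.1 `shimuraCurve_heegnerPoint_grossZagier_kolyvagin`. Proof:
`multiplicativeRankOne_of_endState_upper` with `hUβ := missingUpperBoundAt_of_classX11b_of_ram_of_not_alpha_pub`
(p420149). CONDITIONAL on the items; nothing booked; concludes the registered rung leaf, not the summit.
[folklore] -/
theorem erratumRoadFive_multiplicativeRankOne_of_shimuraCurveInputs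
    (h₁ : OpenInputIMC) (h₂ : EulerHalfOffLocus)
    -- in place of (h₃ : ShimuraDisplays): the three Shimura-curve named facts (`ShimuraCurveInputs`)
    (h₃ : nonempty_shimuraParametrizationData ∧ PastenShimura2024_ribetTakahashiPackage ∧
      shimuraCurve_heegnerPoint_grossZagier_kolyvagin)
    (h₄ : X11aLowerHalf) (h₅ : NonSurjCorner) (h₆ : PublishedInputsFive) :
    Summit.BirchSwinnertonDyer.Rank1Residual.X11b.MultiplicativeRankOne := by
  obtain ⟨hGZ, hKo, hB, hSk, hWu, hGZK, hmod, hnf, hHL, hFHs, hMaz, hBDMTV, hFH, hPT, hEP⟩ := h₆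
  obtain ⟨hJL, hRT, hHK⟩ := h₃
  exact multiplicativeRankOne_of_endState_upper hGZ hKo hB hSk hWu hGZK hmod hnf hHL hFHs hMaz hBDMTV hPT hEP h₁
    h₂ (missingUpperBoundAt_of_classX11b_of_ram_of_not_alpha_pub hSk hGZK hmod hnf hFH hMaz hJL hRT hHK) h₄ h₅

end Summit.BirchSwinnertonDyer.BirchSwinnertonDyer.Theorems

end
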